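import Summits.ResolutionOfSingularities.ResolutionOfSingularities.Theorems.FrobeniusLadderFInjectiveMacaulayficationProp44SliceCurvePlumbing
import Literature.AlgebraicGeometry.Resolution.NearPointsRational
import Literature.AlgebraicGeometry.Resolution.BlowupRelativeDimension
import Literature.AlgebraicGeometry.Resolution.PrimeDivisorIdeals
import Literature.AlgebraicGeometry.Resolution.StalkSpecializesLocalization
import Literature.AlgebraicGeometry.Resolution.CurveCentreNearPointGammaPrimeQuotient
import Literature.AlgebraicGeometry.Resolution.RegularLocalRingsQuotient
import Literature.RingTheory.RegularLocalRing.QuotientDVR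
import HarnessLib

/-!
# Cossart–Piltant 2008, Prop. 4.4 — brick κ″ of the T1 line: the centre after a CURVE step followed by a CURVE step

OURS (res-inputs-p-8b g2; critic R65 (1)(b)/(2): the clause `hPsucc_cv` = (P2) of the ring CONTRACT `false_of_unitChain_tau_one_rational`).
In the `τ = 1` line, let the centre at level `n` be a regular curve `Y = cl{η} ∋ x` presented at the closed point `x` by `(y, u) = 𝓘_{Y,x}`
inside a regular system of parameters `(y, u, w)`, let `x′` be the near point over `x` with `φ y = φ u · y′`, `(y′, φ u, φ w) = 𝔪_{x′}`
(brick κ), and let the NEXT centre be again a curve `Y′ = cl{ζ} ∋ x′` whose generic point `ζ` is a near point over `η`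
(T1-α `tauOneChain_curveStep_succ`, p623079). Then `φ u ∈ 𝓘_{Y′,x′}` and there is a correction `β ∈ 𝔪_x` FROM DOWNSTAIRS with
`𝓘_{Y′,x′} = (y′ + φ β, φ u)`.

Proof: `𝓘_{Y′,x′} = 𝔭_ζ`, `𝓘_{Y,x} = 𝔭_η` (`stalkIdeal_vanishingIdeal_closure`), `φ⁻¹ 𝔭_ζ = 𝔭_η` (`comap_stalkMap_primeOfSpecializes`);
`k(η) → k(ζ)` is onto (`NearPointsRational`) and `𝒪_η = (𝒪_x)_{𝔭_η}`, so every `a′ ∈ 𝒪_{x′}` satisfies `a′ φ b ≡ φ a (mod 𝔭_ζ)` with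
`b ∉ 𝔭_η`; `𝒪_x/𝔭_η` is a discrete valuation ring (regular of dimension `1`) and `φ` is local, so `b` may be taken `1` (valuation rings are
maximal for domination); with `a′ = -y′` this gives `β`, and `(y′ + φβ, φ u)` is a regular pair inside the height-two prime `𝔭_ζ`, hence
equal to it. No new definitions. F-71 / resolution in dim ≥ 4 or char p NOT proved here.
-/

noncomputable section

open CategoryTheory AlgebraicGeometry TopologicalSpace IsLocalRing
open Literature.AlgebraicGeometry.Resolution Scheme.IdealSheafData

namespace Summit.ResolutionOfSingularities.ResolutionOfSingularities.Theorems

namespace CP2008Prop44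

universe u

/-! ## Algebra: a local map out of a valuation ring that is onto up to denominators is onto (mod a prime) -/

/-- **Domination.** `φ : R → R′` a local homomorphism of local rings, `P′ ⊆ R′` prime with `φ⁻¹P′ = P` and `R/P` a valuation ring;
if every `a′ ∈ R′` satisfies `a′·φ b ≡ φ a (mod P′)` for some `a, b ∈ R`, `b ∉ P`, then every `a′` satisfies `a′ ≡ φ a (mod P′)` for some
`a ∈ R` (valuation rings are maximal for domination). [cite: Matsumura1987, Thm. 10.2] -/
theorem exists_sub_map_mem_of_forall_exists_mul_map_sub_map_mem {R R' : Type*} [CommRing R] [CommRing R'] [IsLocalRing R]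
    [IsLocalRing R'] (φ : R →+* R') [IsLocalHom φ] {P : Ideal R} {P' : Ideal R'} [P'.IsPrime] (hPP' : P'.comap φ = P)
    [IsDomain (R ⧸ P)] [ValuationRing (R ⧸ P)]
    (hratio : ∀ a' : R', ∃ a b : R, b ∉ P ∧ a' * φ b - φ a ∈ P') (a' : R') : ∃ a : R, a' - φ a ∈ P' := by
  obtain ⟨a, b, hb, hab⟩ := hratio a'
  have hPle : P' ≤ maximalIdeal R' := IsLocalRing.le_maximalIdeal (Ideal.IsPrime.ne_top inferInstance)
  have hmemP : ∀ r : R, r ∈ P ↔ φ r ∈ P' := fun r => by rw [← hPP', Ideal.mem_comap]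
  have hφb : φ b ∉ P' := fun h => hb ((hmemP b).mpr h)
  obtain ⟨c', hc⟩ := PreValuationRing.cond (Ideal.Quotient.mk P a) (Ideal.Quotient.mk P b)
  obtain ⟨c, rfl⟩ := Ideal.Quotient.mk_surjective c'
  rcases hc with hc | hc
  · -- `a c ≡ b (mod P)`: then `a′ φ c ≡ 1`, `c` is a unit and `a′ ≡ φ c⁻¹`
    rw [← map_mul, Ideal.Quotient.eq] at hc
    have ha : a ∉ P := fun haP => hb (by simpa using P.sub_mem (P.mul_mem_right c haP) hc)
    have hφa : φ a ∉ P' := fun h => ha ((hmemP a).mpr h)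
    have h1 : φ a * (a' * φ c - 1) ∈ P' := by
      have h2 : a' * (φ a * φ c - φ b) ∈ P' := by
        rw [← map_mul, ← map_sub]; exact P'.mul_mem_left _ ((hmemP _).mp hc)
      have : φ a * (a' * φ c - 1) = a' * (φ a * φ c - φ b) + (a' * φ b - φ a) := by ring
      rw [this]; exact P'.add_mem h2 hab
    have h3 : a' * φ c - 1 ∈ P' := ((Ideal.IsPrime.mem_or_mem inferInstance h1).resolve_left hφa)
    have hunit : IsUnit (a' * φ c) := by
      by_contra hnu
      have hm : a' * φ c ∈ maximalIdeal R' := (IsLocalRing.mem_maximalIdeal _).mpr hnu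
      have h1m : (1 : R') ∈ maximalIdeal R' := by simpa using (maximalIdeal R').sub_mem hm (hPle h3)
      exact (IsLocalRing.maximalIdeal.isMaximal R').ne_top ((Ideal.eq_top_iff_one _).mpr h1m)
    have hcunit : IsUnit c := IsLocalHom.map_nonunit c (isUnit_of_mul_isUnit_right hunit)
    obtain ⟨cu, rfl⟩ := hcunit
    refine ⟨↑cu⁻¹, ?_⟩
    have : a' - φ ↑cu⁻¹ = (a' * φ ↑cu - 1) * φ ↑cu⁻¹ := by
      rw [sub_mul, mul_assoc, ← map_mul, Units.mul_inv, map_one, mul_one, one_mul]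
    rw [this]; exact P'.mul_mem_right _ h3
  · -- `b c ≡ a (mod P)`: then `a′ ≡ φ c`
    rw [← map_mul, Ideal.Quotient.eq] at hc
    refine ⟨c, (Ideal.IsPrime.mem_or_mem inferInstance ?_).resolve_left hφb⟩
    have : φ b * (a' - φ c) = (a' * φ b - φ a) - (φ b * φ c - φ a) := by ring
    rw [this, ← map_mul, ← map_sub]
    exact P'.sub_mem hab ((hmemP _).mp hc)

/-! ## The centre after a curve step followed by a curve step -/

variable {X X' : Scheme.{u}} {π : X' ⟶ X}

set_option maxHeartbeats 800000 in
/-- **κ″ — the next centre after a curve step is the corrected strict transform of the centre.** `X` regular, `Y = cl{π ζ}` a regular curve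
centre with `ord J = μ` along it, `π` its blow-up, `x′` a point with `ζ ⤳ x′`, `codim ζ = codim (π ζ) = 2`, `ζ` NEAR (the generic point of
the next curve centre `Y′ = cl{ζ}`); at `x = π x′` (embedding dimension `3`) a regular system `(y, u, w)` with `(y, u) = 𝓘_{Y,x}`, and at `x′`
(embedding dimension `3`) `y′` with `φ y = φ u · y′` and `(y′, φ u, φ w) = 𝔪_{x′}`. Then `φ u ∈ 𝓘_{Y′,x′}` and
`𝓘_{Y′,x′} = (y′ + φ β, φ u)` for some `β ∈ 𝔪_x` — the clause `hPsucc_cv` of the ring contract `false_of_unitChain_tau_one_rational`.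
[cite: CossartPiltant2008, Prop. 4.4 (proof, p. 11), Lemma 4.3 (4)] -/
theorem curveStep_succ_centre [IsLocallyNoetherian X] [IsLocallyNoetherian X'] (hX : Scheme.IsRegular X)
    {Y : Closeds X} (hreg : Scheme.IsRegular (vanishingIdeal Y).subscheme) (hπ : IsBlowup π (vanishingIdeal Y))
    {J : X.IdealSheafData} {μ : ℕ} (hμ : 1 ≤ μ) (hY : ∀ y ∈ (Y : Set X), idealOrder J y = μ)
    {x' : X'} [IsRegularLocalRing (X.presheaf.stalk (π x'))] [IsRegularLocalRing (X'.presheaf.stalk x')]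
    (hd : (maximalIdeal (X.presheaf.stalk (π x'))).spanFinrank = 3) (hd' : (maximalIdeal (X'.presheaf.stalk x')).spanFinrank = 3)
    {ζ : X'} (hζx' : ζ ⤳ x') (hcohζ : Order.coheight ζ = 2) (hcohη : Order.coheight (π ζ) = 2)
    (hYη : (Y : Set X) = closure {π ζ}) (hζnear : IsNear π (vanishingIdeal Y) J μ ζ)
    {Y' : Closeds X'} (hY'ζ : (Y' : Set X') = closure {ζ})
    {y u w : X.presheaf.stalk (π x')} (hgen : Ideal.span {y, u, w} = maximalIdeal _)
    (hyu : Ideal.span {y, u} = stalkIdeal (vanishingIdeal Y) (π x')) {y' : X'.presheaf.stalk x'}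
    (hrel : (π.stalkMap x').hom y = (π.stalkMap x').hom u * y')
    (hgen' : Ideal.span {y', (π.stalkMap x').hom u, (π.stalkMap x').hom w} = maximalIdeal _) :
    (π.stalkMap x').hom u ∈ stalkIdeal (vanishingIdeal Y') x' ∧
      ∃ β ∈ maximalIdeal (X.presheaf.stalk (π x')),
        Ideal.span {y' + (π.stalkMap x').hom β, (π.stalkMap x').hom u} = stalkIdeal (vanishingIdeal Y') x' := by
  classical
  -- `Set.range ![a, b] = {a, b}` (kept local: the tree's copies live in unrelated modules)
  have range_vecCons_two : ∀ {α : Type u} (a b : α), Set.range ![a, b] = {a, b} := by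
    intro α a b
    ext t
    simp only [Set.mem_range, Set.mem_insert_iff, Set.mem_singleton_iff]
    constructor
    · rintro ⟨i, rfl⟩
      fin_cases i
      · exact Or.inl rfl
      · exact Or.inr rfl
    · rintro (h | h)
      · exact ⟨0, h.symm⟩
      · exact ⟨1, h.symm⟩
  set φ := (π.stalkMap x').hom with hφ
  have hηx : π ζ ⤳ π x' := hζx'.map π.base.hom.continuous
  -- the two primes
  have hY'eq : Y' = ⟨closure {ζ}, isClosed_closure⟩ := TopologicalSpace.Closeds.ext hY'ζ
  have hYeq : Y = ⟨closure {π ζ}, isClosed_closure⟩ := TopologicalSpace.Closeds.ext hYη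
  have hP' : stalkIdeal (vanishingIdeal Y') x' = primeOfSpecializes hζx' := by
    rw [hY'eq]; exact stalkIdeal_vanishingIdeal_closure hζx'
  have hP : stalkIdeal (vanishingIdeal Y) (π x') = primeOfSpecializes hηx := by
    rw [hYeq]; exact stalkIdeal_vanishingIdeal_closure hηx
  haveI hP'prime : (stalkIdeal (vanishingIdeal Y') x').IsPrime := by rw [hP']; infer_instance
  have hcomap : (stalkIdeal (vanishingIdeal Y') x').comap φ = stalkIdeal (vanishingIdeal Y) (π x') := by
    rw [hP', hP, hφ, comap_stalkMap_primeOfSpecializes]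
  have hmemP : ∀ r, r ∈ stalkIdeal (vanishingIdeal Y) (π x') ↔ φ r ∈ stalkIdeal (vanishingIdeal Y') x' := fun r => by
    rw [← hcomap, Ideal.mem_comap]
  have hu : u ∈ stalkIdeal (vanishingIdeal Y) (π x') := hyu ▸ Ideal.subset_span (by simp)
  have huP' : φ u ∈ stalkIdeal (vanishingIdeal Y') x' := (hmemP u).mp hu
  refine ⟨huP', ?_⟩
  -- `k(η) → k(ζ)` is onto (near point over the generic point of the regular centre)
  haveI := hX (π ζ)
  obtain ⟨p, hpr, hpY⟩ := exists_rsopPair_of_coheight_eq_two hcohη hYη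
  have hsurj := hπ.residue_comp_stalkMap_surjective_of_isNear hX hreg hμ hY hpr hpY hζnear
  -- `𝒪_η = (𝒪_x)_{𝔭_η}`
  letI alg := (X.presheaf.stalkSpecializes hηx).hom.toAlgebra
  haveI hloc : IsLocalization.AtPrime (X.presheaf.stalk (π ζ)) (primeOfSpecializes hηx) :=
    isLocalizationAtPrime_stalkSpecializes hηx
  have hnat : ∀ a : X.presheaf.stalk (π x'),
      (π.stalkMap ζ).hom ((X.presheaf.stalkSpecializes hηx).hom a) = (X'.presheaf.stalkSpecializes hζx').hom (φ a) :=
    fun a => Scheme.Hom.stalkSpecializes_stalkMap_apply π ζ x' hζx' a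
  have hratio : ∀ a' : X'.presheaf.stalk x', ∃ a b : X.presheaf.stalk (π x'),
      b ∉ stalkIdeal (vanishingIdeal Y) (π x') ∧ a' * φ b - φ a ∈ stalkIdeal (vanishingIdeal Y') x' := by
    intro a'
    obtain ⟨g, hg⟩ := hsurj (IsLocalRing.residue _ ((X'.presheaf.stalkSpecializes hζx').hom a'))
    obtain ⟨⟨a, b⟩, hab⟩ := IsLocalization.surj (primeOfSpecializes hηx).primeCompl g
    refine ⟨a, b, by rw [hP]; exact b.2, ?_⟩
    rw [hP']
    change (X'.presheaf.stalkSpecializes hζx').hom (a' * φ b - φ a) ∈ maximalIdeal _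
    have hab' : g * (X.presheaf.stalkSpecializes hηx).hom b = (X.presheaf.stalkSpecializes hηx).hom a := hab
    rw [map_sub, map_mul, ← hnat, ← hnat, ← hab', map_mul, ← sub_mul]
    apply Ideal.mul_mem_right
    simp only [RingHom.coe_comp, Function.comp_apply] at hg
    rw [← IsLocalRing.residue_eq_zero_iff, map_sub, hg, sub_self]
  -- `𝒪_x / 𝔭_η` is a discrete valuation ring
  have hdim : ringKrullDim (X.presheaf.stalk (π x')) = 3 := by
    have h := (isRegularLocalRing_iff (X.presheaf.stalk (π x'))).mp inferInstance
    rw [hd] at h; exact_mod_cast h.symm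
  have hrange1 : ∀ t : X.presheaf.stalk (π x'), Set.range ![t] = {t} := fun t => by
    ext s; simp [eq_comm]
  have hpair : IsRsopPart ![y, u] := by
    refine ⟨inferInstance, 1, ![w], by rw [hdim]; rfl, ?_⟩
    rw [range_vecCons_two, hrange1, ← hgen, Set.union_singleton, Set.insert_comm w y, Set.pair_comm w u]
  have hPspan : Ideal.span (Set.range ![y, u]) = stalkIdeal (vanishingIdeal Y) (π x') := by rw [range_vecCons_two, hyu]
  haveI hregq : IsRegularLocalRing (X.presheaf.stalk (π x') ⧸ stalkIdeal (vanishingIdeal Y) (π x')) := by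
    rw [← hPspan]; exact hpair.isRegularLocalRing_quotient
  haveI : IsDomain (X.presheaf.stalk (π x') ⧸ stalkIdeal (vanishingIdeal Y) (π x')) := isDomain_of_isRegularLocalRing _
  have hdim1 : ringKrullDim (X.presheaf.stalk (π x') ⧸ stalkIdeal (vanishingIdeal Y) (π x')) = 1 := by
    have h := hpair.ringKrullDim_quotient_add
    rw [hPspan, hdim] at h
    obtain ⟨n, hn⟩ := exists_nat_cast_eq_ringKrullDim (R := X.presheaf.stalk (π x') ⧸ stalkIdeal (vanishingIdeal Y) (π x'))
    rw [hn] at h ⊢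
    have h' : n + 2 = 3 := by exact_mod_cast h
    have hn1 : n = 1 := by omega
    rw [hn1]; rfl
  haveI : IsDiscreteValuationRing (X.presheaf.stalk (π x') ⧸ stalkIdeal (vanishingIdeal Y) (π x')) :=
    Literature.RingTheory.RegularLocalRing.isDiscreteValuationRing_of_ringKrullDim_eq_one hdim1
  -- the correction `β`
  obtain ⟨β, hβ⟩ := exists_sub_map_mem_of_forall_exists_mul_map_sub_map_mem φ hcomap hratio (-y')
  have hya : y' + φ β ∈ stalkIdeal (vanishingIdeal Y') x' := by
    have : y' + φ β = -(-y' - φ β) := by ring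
    rw [this]; exact neg_mem hβ
  have hy' : y' ∈ maximalIdeal (X'.presheaf.stalk x') := hgen' ▸ Ideal.subset_span (by simp)
  have hP'le : stalkIdeal (vanishingIdeal Y') x' ≤ maximalIdeal _ := IsLocalRing.le_maximalIdeal hP'prime.ne_top
  have hβ𝔪 : β ∈ maximalIdeal (X.presheaf.stalk (π x')) := by
    by_contra hβu
    have hunit : IsUnit (φ β) := (IsLocalRing.notMem_maximalIdeal.mp hβu).map φ
    have h1 : y' + φ β ∈ maximalIdeal (X'.presheaf.stalk x') := hP'le hya
    have h2 : φ β = (y' + φ β) - y' := by ring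
    have : φ β ∈ maximalIdeal (X'.presheaf.stalk x') := by rw [h2]; exact sub_mem h1 hy'
    exact (IsLocalRing.mem_maximalIdeal _).mp this hunit
  refine ⟨β, hβ𝔪, ?_⟩
  -- `φ β ∈ (φ u, φ w)` and `(y′ + φβ, φ u, φ w) = 𝔪_{x′}`
  have hφβ : φ β ∈ Ideal.span {φ u, φ w} := by
    have h1 : φ β ∈ (maximalIdeal (X.presheaf.stalk (π x'))).map φ := Ideal.mem_map_of_mem φ hβ𝔪
    rw [← hgen, Ideal.map_span] at h1
    refine (Ideal.span_le.mpr ?_) h1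
    rintro _ ⟨r, hr, rfl⟩
    simp only [Set.mem_insert_iff, Set.mem_singleton_iff] at hr
    rcases hr with rfl | rfl | rfl
    · rw [show φ r = φ u * y' from hrel]
      exact Ideal.mul_mem_right _ _ (Ideal.subset_span (by simp))
    · exact Ideal.subset_span (by simp)
    · exact Ideal.subset_span (by simp)
  have hspan3 : Ideal.span {y' + φ β, φ u, φ w} = maximalIdeal (X'.presheaf.stalk x') := by
    rw [← hgen']
    have hsub : Ideal.span {φ u, φ w} ≤ Ideal.span {y' + φ β, φ u, φ w} :=
      Ideal.span_mono (Set.subset_insert _ _)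
    have hsub' : Ideal.span {φ u, φ w} ≤ Ideal.span {y', φ u, φ w} :=
      Ideal.span_mono (Set.subset_insert _ _)
    apply le_antisymm
    · rw [Ideal.span_le]
      rintro t ht
      simp only [Set.mem_insert_iff, Set.mem_singleton_iff] at ht
      rcases ht with rfl | rfl | rfl
      · exact Ideal.add_mem _ (Ideal.subset_span (by simp)) (hsub' hφβ)
      · exact Ideal.subset_span (by simp)
      · exact Ideal.subset_span (by simp)
    · rw [Ideal.span_le]
      rintro t ht
      simp only [Set.mem_insert_iff, Set.mem_singleton_iff] at ht
      rcases ht with rfl | rfl | rfl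
      · have h := Ideal.sub_mem _ (Ideal.subset_span (s := ({t + φ β, φ u, φ w} : Set _)) (by simp : t + φ β ∈ _)) (hsub hφβ)
        simpa using h
      · exact Ideal.subset_span (by simp)
      · exact Ideal.subset_span (by simp)
  -- the regular pair and the height count
  have hdim' : ringKrullDim (X'.presheaf.stalk x') = 3 := by
    have h := (isRegularLocalRing_iff (X'.presheaf.stalk x')).mp inferInstance
    rw [hd'] at h; exact_mod_cast h.symm
  have hrange1' : ∀ t : X'.presheaf.stalk x', Set.range ![t] = {t} := fun t => by
    ext s; simp [eq_comm]
  have hv : IsRsopPart ![y' + φ β, φ u] := by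
    refine ⟨inferInstance, 1, ![φ w], by rw [hdim']; rfl, ?_⟩
    rw [range_vecCons_two, hrange1', ← hspan3, Set.union_singleton, Set.insert_comm (φ w) (y' + φ β),
      Set.pair_comm (φ w) (φ u)]
  have hle : Ideal.span (Set.range ![y' + φ β, φ u]) ≤ stalkIdeal (vanishingIdeal Y') x' := by
    rw [range_vecCons_two, Ideal.span_le]
    rintro t ht
    simp only [Set.mem_insert_iff, Set.mem_singleton_iff] at ht
    rcases ht with rfl | rfl
    · exact hya
    · exact huP'
  have hh : (stalkIdeal (vanishingIdeal Y') x').height ≤ 2 := by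
    rw [hP']
    have := coe_height_primeOfSpecializes hζx'
    rw [hcohζ] at this
    have h2 : (primeOfSpecializes hζx').height = 2 := by exact_mod_cast this
    exact h2.le
  have := hv.span_range_eq_of_le_of_height_le hle hh
  rwa [range_vecCons_two] at this

end CP2008Prop44

end Summit.ResolutionOfSingularities.ResolutionOfSingularities.Theorems

end
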